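import Mathlib
import HarnessLib
import Summits.Ventures.LatticeQCDFlow.Exactness.IMHMultipleTryExact
import Summits.Ventures.LatticeQCDFlow.Exactness.IMHMultiProposalStickingFloor

/-!
# No free lunch for the multiple-try rule either: from a configuration of weight `w(x)` the multiple-try flow sampler with `n` proposals moves with
# probability at most `n/w(x)` — escaping a heavy configuration costs `≳ w(x)/2` flow proposals in total, batched or not

HONEST FRAMING: exact (Metropolis-corrected) sampling algorithms for lattice gauge theory;
figures of merit are autocorrelation/cost numbers at stated couplings and volumes; no
continuum-physics claim.

Venture `LatticeQCDFlow` (cell pub-lqcd), topic `Exactness`; FANOUT row 30 (lean-1, GEN-42).  NEW WORK of the cell, the multiple-try twin of this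
generation's `IMHMultiProposalStickingFloor` (pool selection: `P(x, {x}) ≥ w(x)/(w(x) + n)`), over `IMHMultipleTryExact` (def-free multiple-try
kernel `hP`; `looPoolWeight_zero_cons`) and `IMHMultiProposalStickingFloor` (`integral_sum_weight_eq_of_integrable`, `iterate_bind_apply_self_ge`).
The multiple-try reference weight `S_{J+1} = w(x) + Σ_{i≠J} w(y_i)` always contains the current weight, so each term of the move probability is at
most `w(y_J)/w(x)` — no Jensen step is needed.

## Results (no `sorry`, no new definitions)
* `weight_le_looPoolWeight_succ` — `w(x) ≤ S_{J+1}(x ∷ y)`; `mtm_move_integrand_le` — `Σ_J w(y_J)min(S_0⁻¹, S_{J+1}⁻¹) ≤ (Σ_J w(y_J))/w(x)`;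
  **`mtm_move_le`** — the move probability from `x` is at most `n/w(x)` (normalised weight); **`mtm_apply_self_ge`** — `P(x, {x}) ≥ 1 − n/w(x)`.
* **`mtm_sticking_floor`** — `(δ_xPᵗ)({x}) ≥ (1 − n/w(x))ᵗ` (for `n ≤ w(x)`); **`mtm_total_proposals_ge`** — if after `t` updates the chain has left `x`
  with probability `≥ ½`, then `t·n ≥ w(x)/2`: as for pool selection, batching parallelises the `≈ w(x)` proposals an escape costs without reducing them.
Reading (gauge files): with either batch rule the number of flow-generated gauge fields spent before a configuration of importance weight `W` is
left is of order `W`; `IMHMultipleTryMinorisation`'s rate `(m + 1)/(W + m)` shows the order is attained.  NOT CLAIMED: anything at equilibrium.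
-/

noncomputable section

namespace Summit.Ventures.LatticeQCDFlow.Exactness

open MeasureTheory ProbabilityTheory Function Finset
open scoped ENNReal

variable {Ω : Type*} [MeasurableSpace Ω] {q : Measure Ω} [IsProbabilityMeasure q] {w : Ω → ℝ} {n : ℕ}

omit [MeasurableSpace Ω] in
/-- The current weight is part of every multiple-try reference weight: `w(x) ≤ S_{J+1}(x ∷ y)`. [ours, bookkeeping] -/
theorem weight_le_looPoolWeight_succ (x : Ω) (y : Fin n → Ω) (J : Fin n) :
    ENNReal.ofReal (w x) ≤ ∑ i ∈ univ.erase J.succ, ENNReal.ofReal (w (Fin.cons (α := fun _ : Fin (n + 1) => Ω) x y i)) := by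
  have h0 : (0 : Fin (n + 1)) ∈ univ.erase J.succ := mem_erase.2 ⟨(Fin.succ_ne_zero J).symm, mem_univ _⟩
  have := single_le_sum (f := fun i => ENNReal.ofReal (w (Fin.cons (α := fun _ : Fin (n + 1) => Ω) x y i))) (fun i _ => bot_le) h0
  simpa only [Fin.cons_zero] using this

omit [MeasurableSpace Ω] in
/-- **Each term of the move probability is at most `w(y_J)/w(x)`**: `Σ_J w(y_J)·min(S_0⁻¹, S_{J+1}⁻¹) ≤ (Σ_J w(y_J))·w(x)⁻¹`. [ours] -/
theorem mtm_move_integrand_le (x : Ω) (y : Fin n → Ω) :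
    ∑ J : Fin n, ENNReal.ofReal (w (Fin.cons (α := fun _ : Fin (n + 1) => Ω) x y J.succ)) *
        min (∑ i ∈ univ.erase 0, ENNReal.ofReal (w (Fin.cons (α := fun _ : Fin (n + 1) => Ω) x y i)))⁻¹
          (∑ i ∈ univ.erase J.succ, ENNReal.ofReal (w (Fin.cons (α := fun _ : Fin (n + 1) => Ω) x y i)))⁻¹ ≤
      (∑ J : Fin n, ENNReal.ofReal (w (y J))) * (ENNReal.ofReal (w x))⁻¹ := by
  rw [sum_mul]
  refine sum_le_sum fun J _ => ?_
  simp only [Fin.cons_succ]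
  exact mul_le_mul' le_rfl ((min_le_right _ _).trans (ENNReal.inv_le_inv.2 (weight_le_looPoolWeight_succ x y J)))

/-- **THE MOVE PROBABILITY FROM `x` IS AT MOST `n/w(x)`** (normalised positive weight). [ours] -/
theorem mtm_move_le (hw : Measurable w) (hw0 : ∀ y, 0 < w y) (h1 : ∫ y, w y ∂q = 1) (x : Ω) :
    ∫⁻ y, ∑ J : Fin n, ENNReal.ofReal (w (Fin.cons (α := fun _ : Fin (n + 1) => Ω) x y J.succ)) *
        min (∑ i ∈ univ.erase 0, ENNReal.ofReal (w (Fin.cons (α := fun _ : Fin (n + 1) => Ω) x y i)))⁻¹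
          (∑ i ∈ univ.erase J.succ, ENNReal.ofReal (w (Fin.cons (α := fun _ : Fin (n + 1) => Ω) x y i)))⁻¹ ∂(Measure.pi fun _ : Fin n => q) ≤
      (n : ℝ≥0∞) * (ENNReal.ofReal (w x))⁻¹ := by
  have hwi : Integrable w q := by
    by_contra h; rw [integral_undef h] at h1; exact zero_ne_one h1
  have hS : ∫⁻ y, ∑ J : Fin n, ENNReal.ofReal (w (y J)) ∂(Measure.pi fun _ : Fin n => q) = n := by
    have hint : Integrable (fun y : Fin n → Ω => ∑ J, w (y J)) (Measure.pi fun _ : Fin n => q) :=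
      integrable_finsetSum _ fun i _ => ((measurePreserving_eval (fun _ : Fin n => q) i).integrable_comp hw.aestronglyMeasurable).2 hwi
    have heq : (fun y : Fin n → Ω => ∑ J, ENNReal.ofReal (w (y J))) = fun y => ENNReal.ofReal (∑ J, w (y J)) := by
      funext y; rw [ENNReal.ofReal_sum_of_nonneg fun J _ => (hw0 _).le]
    rw [heq, ← ofReal_integral_eq_lintegral_ofReal hint (ae_of_all _ fun y => sum_nonneg fun J _ => (hw0 _).le),
      integral_sum_weight_eq_of_integrable hw hwi, h1, mul_one, ENNReal.ofReal_natCast]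
  calc _ ≤ ∫⁻ y, (∑ J : Fin n, ENNReal.ofReal (w (y J))) * (ENNReal.ofReal (w x))⁻¹ ∂(Measure.pi fun _ : Fin n => q) :=
        lintegral_mono fun y => mtm_move_integrand_le x y
    _ = (∫⁻ y, ∑ J : Fin n, ENNReal.ofReal (w (y J)) ∂(Measure.pi fun _ : Fin n => q)) * (ENNReal.ofReal (w x))⁻¹ :=
        lintegral_mul_const _ (Finset.measurable_sum _ fun J _ => hw.ennreal_ofReal.comp (measurable_pi_apply J))
    _ = (n : ℝ≥0∞) * (ENNReal.ofReal (w x))⁻¹ := by rw [hS]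

/-- **THE HOLDING FLOOR: `P(x, {x}) ≥ 1 − n/w(x)`** for the multiple-try kernel from every configuration. [ours] -/
theorem mtm_apply_self_ge (hw : Measurable w) (hw0 : ∀ y, 0 < w y) (h1 : ∫ y, w y ∂q = 1) (P : Kernel Ω Ω)
    (hP : ∀ (x : Ω) {B : Set Ω}, MeasurableSet B → P x B =
      ∫⁻ y, ∑ J : Fin n, ENNReal.ofReal (w (Fin.cons (α := fun _ : Fin (n + 1) => Ω) x y J.succ)) *
          B.indicator (fun _ => (1 : ℝ≥0∞)) (Fin.cons (α := fun _ : Fin (n + 1) => Ω) x y J.succ) *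
          min (∑ i ∈ univ.erase 0, ENNReal.ofReal (w (Fin.cons (α := fun _ : Fin (n + 1) => Ω) x y i)))⁻¹
            (∑ i ∈ univ.erase J.succ, ENNReal.ofReal (w (Fin.cons (α := fun _ : Fin (n + 1) => Ω) x y i)))⁻¹ ∂(Measure.pi fun _ : Fin n => q) +
        (1 - ∫⁻ y, ∑ J : Fin n, ENNReal.ofReal (w (Fin.cons (α := fun _ : Fin (n + 1) => Ω) x y J.succ)) *
          min (∑ i ∈ univ.erase 0, ENNReal.ofReal (w (Fin.cons (α := fun _ : Fin (n + 1) => Ω) x y i)))⁻¹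
            (∑ i ∈ univ.erase J.succ, ENNReal.ofReal (w (Fin.cons (α := fun _ : Fin (n + 1) => Ω) x y i)))⁻¹ ∂(Measure.pi fun _ : Fin n => q)) *
          B.indicator 1 x)
    (x : Ω) (hx : MeasurableSet ({x} : Set Ω)) :
    1 - (n : ℝ≥0∞) * (ENNReal.ofReal (w x))⁻¹ ≤ P x {x} := by
  rw [hP x hx, Set.indicator_of_mem (Set.mem_singleton x), Pi.one_apply, mul_one]
  exact (tsub_le_tsub_left (mtm_move_le hw hw0 h1 x) 1).trans le_add_self

/-- **THE STICKING FLOOR over `t` updates: `(δ_x Pᵗ)({x}) ≥ (1 − n/w(x))ᵗ`.** [ours] -/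
theorem mtm_sticking_floor [MeasurableSingletonClass Ω] (hw : Measurable w) (hw0 : ∀ y, 0 < w y) (h1 : ∫ y, w y ∂q = 1) (P : Kernel Ω Ω)
    (hP : ∀ (x : Ω) {B : Set Ω}, MeasurableSet B → P x B =
      ∫⁻ y, ∑ J : Fin n, ENNReal.ofReal (w (Fin.cons (α := fun _ : Fin (n + 1) => Ω) x y J.succ)) *
          B.indicator (fun _ => (1 : ℝ≥0∞)) (Fin.cons (α := fun _ : Fin (n + 1) => Ω) x y J.succ) *
          min (∑ i ∈ univ.erase 0, ENNReal.ofReal (w (Fin.cons (α := fun _ : Fin (n + 1) => Ω) x y i)))⁻¹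
            (∑ i ∈ univ.erase J.succ, ENNReal.ofReal (w (Fin.cons (α := fun _ : Fin (n + 1) => Ω) x y i)))⁻¹ ∂(Measure.pi fun _ : Fin n => q) +
        (1 - ∫⁻ y, ∑ J : Fin n, ENNReal.ofReal (w (Fin.cons (α := fun _ : Fin (n + 1) => Ω) x y J.succ)) *
          min (∑ i ∈ univ.erase 0, ENNReal.ofReal (w (Fin.cons (α := fun _ : Fin (n + 1) => Ω) x y i)))⁻¹
            (∑ i ∈ univ.erase J.succ, ENNReal.ofReal (w (Fin.cons (α := fun _ : Fin (n + 1) => Ω) x y i)))⁻¹ ∂(Measure.pi fun _ : Fin n => q)) *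
          B.indicator 1 x)
    (x : Ω) (t : ℕ) :
    (1 - (n : ℝ≥0∞) * (ENNReal.ofReal (w x))⁻¹) ^ t ≤ ((fun μ : Measure Ω => μ.bind P)^[t] (Measure.dirac x)) {x} :=
  iterate_bind_apply_self_ge P (mtm_apply_self_ge hw hw0 h1 P hP x (measurableSet_singleton x)) t

omit [MeasurableSpace Ω] in
/-- The `ℝ≥0∞` floor in real terms: `ofReal (1 − n/w(x)) = 1 − n·(ofReal w(x))⁻¹`. [ours, bookkeeping] -/
theorem ofReal_one_sub_div_eq {x : Ω} (hw0x : 0 < w x) (n : ℕ) :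
    ENNReal.ofReal (1 - n / w x) = 1 - (n : ℝ≥0∞) * (ENNReal.ofReal (w x))⁻¹ := by
  rw [← ENNReal.ofReal_natCast, ← ENNReal.ofReal_inv_of_pos hw0x, ← ENNReal.ofReal_mul n.cast_nonneg, ← ENNReal.ofReal_one,
    ← ENNReal.ofReal_sub _ (by positivity), div_eq_mul_inv]

/-- **THE TOTAL-PROPOSAL COUNT**: if after `t` multiple-try updates of size `n` the chain started at `x` has left `x` with probability at least `½`,
then `t·n ≥ w(x)/2` (when `n ≤ w(x)`; trivially otherwise). [ours] -/
theorem mtm_total_proposals_ge [MeasurableSingletonClass Ω] (hw : Measurable w) (hw0 : ∀ y, 0 < w y) (h1 : ∫ y, w y ∂q = 1) (P : Kernel Ω Ω)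
    [IsMarkovKernel P]
    (hP : ∀ (x : Ω) {B : Set Ω}, MeasurableSet B → P x B =
      ∫⁻ y, ∑ J : Fin n, ENNReal.ofReal (w (Fin.cons (α := fun _ : Fin (n + 1) => Ω) x y J.succ)) *
          B.indicator (fun _ => (1 : ℝ≥0∞)) (Fin.cons (α := fun _ : Fin (n + 1) => Ω) x y J.succ) *
          min (∑ i ∈ univ.erase 0, ENNReal.ofReal (w (Fin.cons (α := fun _ : Fin (n + 1) => Ω) x y i)))⁻¹
            (∑ i ∈ univ.erase J.succ, ENNReal.ofReal (w (Fin.cons (α := fun _ : Fin (n + 1) => Ω) x y i)))⁻¹ ∂(Measure.pi fun _ : Fin n => q) +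
        (1 - ∫⁻ y, ∑ J : Fin n, ENNReal.ofReal (w (Fin.cons (α := fun _ : Fin (n + 1) => Ω) x y J.succ)) *
          min (∑ i ∈ univ.erase 0, ENNReal.ofReal (w (Fin.cons (α := fun _ : Fin (n + 1) => Ω) x y i)))⁻¹
            (∑ i ∈ univ.erase J.succ, ENNReal.ofReal (w (Fin.cons (α := fun _ : Fin (n + 1) => Ω) x y i)))⁻¹ ∂(Measure.pi fun _ : Fin n => q)) *
          B.indicator 1 x)
    (x : Ω) (t : ℕ) (hnx : (n : ℝ) ≤ w x) (ht : (((fun μ : Measure Ω => μ.bind P)^[t] (Measure.dirac x)) {x}).toReal ≤ 1 / 2) :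
    w x / 2 ≤ t * n := by
  set μ := (fun μ : Measure Ω => μ.bind P)^[t] (Measure.dirac x) with hμ
  have hwx := hw0 x
  have hr0 : 0 ≤ 1 - n / w x := by rw [sub_nonneg, div_le_one hwx]; exact hnx
  -- `(1 − n/w x)^t ≤ μ{x} ≤ 1/2`
  have hfloor : (1 - n / w x) ^ t ≤ (μ {x}).toReal := by
    have h := mtm_sticking_floor hw hw0 h1 P hP x t
    rw [← ofReal_one_sub_div_eq hwx, ← ENNReal.ofReal_pow hr0] at h
    have hne : μ {x} ≠ ⊤ := by
      refine ne_top_of_le_ne_top ENNReal.one_ne_top ?_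
      -- `μ` is a probability law: iterate of a Markov bind from a Dirac
      have : ∀ s : ℕ, IsProbabilityMeasure ((fun μ : Measure Ω => μ.bind P)^[s] (Measure.dirac x)) := by
        intro s
        induction s with
        | zero => simpa using (inferInstance : IsProbabilityMeasure (Measure.dirac x))
        | succ s ih =>
          rw [Function.iterate_succ_apply']
          haveI := ih
          exact ⟨by rw [Measure.bind_apply MeasurableSet.univ (Kernel.aemeasurable _)]; simp⟩
      haveI := this t
      exact prob_le_one
    exact (ENNReal.ofReal_le_iff_le_toReal hne).1 h
  -- Bernoulli: `1 − t·(n/w x) ≤ (1 − n/w x)^t`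
  have hB : 1 - t * (n / w x) ≤ (1 - n / w x) ^ t := by
    have h := one_add_mul_le_pow (show (-2 : ℝ) ≤ -(n / w x) by
      have : n / w x ≤ 1 := (div_le_one hwx).2 hnx; linarith) t
    calc 1 - t * (n / w x) = 1 + t * (-(n / w x)) := by ring
      _ ≤ (1 + -(n / w x)) ^ t := h
      _ = (1 - n / w x) ^ t := by ring
  have hkey : 1 / 2 ≤ t * (n / w x) := by linarith
  rw [mul_div_assoc'] at hkey
  have := (le_div_iff₀ hwx).1 hkey
  linarith

end Summit.Ventures.LatticeQCDFlow.Exactness
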